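import Mathlib
import HarnessLib
import Summits.ValiantsHypothesis.ValiantsHypothesis.Theses.PermanentalCones
import Literature.Computability.AlgebraicComplexity.DeterminantalComplexity

/-!
# ValiantsHypothesis / PermanentalCones — `HyperbolicVPShadow`, line `birth`: the two bridges
around the load-bearing stub

Crux `HyperbolicVPShadow` (item `stmt-ValiantsHypothesis-8655`), line `birth`
(`Cruxes/HyperbolicVPShadow/Lines/birth.lean`). The line splits the crux into

* stub A `stub_linearRealSpectrumNormalForm` — an affine real determinantal representation of a
  homogeneous hyperbolic form is replaced by a LINEAR pencil with only real eigenvalues and the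
  same closed cone (linear algebra), and
* stub B `stub_realSpectrumShadow` — linear spaces of real matrices with only real eigenvalues have
  "nonnegative spectrum" cones that are lifted-LMI sets of size `2^((log₂ N + c)^c)`.

This support file places stub B exactly: it is the route's crux #3 `HyperbolicDetShadow`
(item `stmt-ValiantsHypothesis-8653`) in normal form.

* `permanentalCones_realSpectrumShadow_of_hyperbolicDetShadow` : `HyperbolicDetShadow →` (stub B).
  Proof: for a real-spectrum linear pencil `P` in `n` variables, the pencil
  `x ↦ Σ_j x_j P(δ_j) + x_n · 1` in `n + 1` variables is an affine (indeed linear) determinantal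
  representation of its determinant `h`, a form of degree `N` hyperbolic w.r.t. `e_n = δ_n`
  (`h(e_n) = 1`; a complex zero `z` of `z ↦ h(x + z e_n)` makes `-(x_n + z)` an eigenvalue of
  `P(x_0, …, x_{n-1})`, hence real); `HyperbolicDetShadow` describes its closed cone by a lifted LMI
  of size `≤ 2^((log₂ N + c)^c)`, and the section `x_n = 0` of that description (composition of the
  linear map with `x ↦ (x, 0)`) describes `{x : ∀ τ > 0, det (P x + τ·1) ≠ 0}` with the same size.
* `permanentalCones_realSpectrumShadow_iff_hyperbolicDetShadow` : (stub A) `→` ((stub B) `↔`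
  `HyperbolicDetShadow`) (direct composition for `→`, same `c`; bridge 1 for `←`).

Hence, once stub A lands, stub B and `HyperbolicDetShadow` are equivalent, and the line `birth` is
closed exactly modulo item `stmt-ValiantsHypothesis-8653`.
-/

-- `<Problem> = <Summit>` for this single-conjunct summit (lakefile sets the same option tree-wide).
set_option linter.dupNamespace false

namespace Summit.ValiantsHypothesis.ValiantsHypothesis.Theorems

open MvPolynomial Literature.Computability.AlgebraicComplexity
open Summit.ValiantsHypothesis.ValiantsHypothesis.Theses.PermanentalCones

section LinearPencil

variable {ι : Type*} {N : ℕ}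

/-- The determinant of a square matrix of linear forms of size `N` is a form of degree `N`.
[folklore] -/
theorem permanentalCones_isHomogeneous_det_of_linear
    (M : Matrix (Fin N) (Fin N) (MvPolynomial ι ℝ)) (hM : ∀ i l, (M i l).IsHomogeneous 1) :
    M.det.IsHomogeneous N := by
  rw [Matrix.det_apply]
  refine IsHomogeneous.sum _ _ _ fun π _ => ?_
  have hprod := IsHomogeneous.prod (Finset.univ : Finset (Fin N)) (fun i => M (π i) i)
    (fun _ => 1) fun i _ => hM (π i) i
  simp only [Finset.sum_const, Finset.card_univ, Fintype.card_fin, smul_eq_mul, mul_one] at hprod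
  rw [Units.smul_def]
  exact zsmul_mem ((mem_homogeneousSubmodule _ _).2 hprod) _

variable [Fintype ι]

/-- Entries of the linear pencil `Σ_j X_j • Q_j` are linear forms: total degree `≤ 1`. [folklore] -/
theorem permanentalCones_totalDegree_sum_C_mul_X_le (c : ι → ℝ) :
    (∑ j, C (c j) * X j : MvPolynomial ι ℝ).totalDegree ≤ 1 :=
  (totalDegree_finsetSum _ _).trans (Finset.sup_le fun j _ =>
    (totalDegree_mul _ _).trans (by
      rw [totalDegree_C, totalDegree_X, zero_add]))

/-- Entries of the linear pencil `Σ_j X_j • Q_j` are homogeneous of degree `1`. [folklore] -/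
theorem permanentalCones_isHomogeneous_sum_C_mul_X (c : ι → ℝ) :
    (∑ j, C (c j) * X j : MvPolynomial ι ℝ).IsHomogeneous 1 :=
  IsHomogeneous.sum _ _ _ fun _ _ => isHomogeneous_C_mul_X _ _

/-- Real evaluation of the linear pencil with coefficient matrices `Q j`:
`(Σ_j X_j • Q_j)(x) = Σ_j x_j • Q_j`. [folklore] -/
theorem permanentalCones_linearPencil_map_eval (Q : ι → Matrix (Fin N) (Fin N) ℝ) (x : ι → ℝ) :
    (Matrix.of fun i l => (∑ j, C (Q j i l) * X j : MvPolynomial ι ℝ)).map (eval x) =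
      ∑ j, x j • Q j := by
  ext i l
  simp only [Matrix.map_apply, Matrix.of_apply, map_sum, map_mul, eval_C, eval_X,
    Matrix.sum_apply, Matrix.smul_apply, smul_eq_mul]
  exact Finset.sum_congr rfl fun j _ => mul_comm _ _

/-- Complex evaluation of the complexified linear pencil:
`(Σ_j X_j • Q_j)(w) = Σ_j w_j • Q_j` for `w ∈ ℂ^ι`. [folklore] -/
theorem permanentalCones_linearPencil_map_map_eval (Q : ι → Matrix (Fin N) (Fin N) ℝ)
    (w : ι → ℂ) :
    ((Matrix.of fun i l => (∑ j, C (Q j i l) * X j : MvPolynomial ι ℝ)).map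
        (MvPolynomial.map (algebraMap ℝ ℂ))).map (eval w) =
      ∑ j, w j • (Q j).map (algebraMap ℝ ℂ) := by
  ext i l
  simp only [Matrix.map_apply, Matrix.of_apply, map_sum, map_mul, map_C, map_X, eval_C, eval_X,
    Matrix.sum_apply, Matrix.smul_apply, smul_eq_mul]
  exact Finset.sum_congr rfl fun j _ => mul_comm _ _

/-- `det (M(x)) = (det M)(x)` for a matrix of polynomials and a ring hom evaluation. [folklore] -/
theorem permanentalCones_det_map_ringHom {R S : Type*} [CommRing R] [CommRing S]
    (φ : R →+* S) (M : Matrix (Fin N) (Fin N) R) : (M.map φ).det = φ M.det := by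
  rw [← RingHom.mapMatrix_apply, ← RingHom.map_det]

end LinearPencil

section Slack

variable {n N : ℕ}

/-- A linear map on `ℝ^n` is determined by its values on the coordinate vectors:
`P x = Σ_j x_j • P(δ_j)`. [folklore] -/
theorem permanentalCones_linearMap_apply_eq_sum {V : Type*} [AddCommGroup V] [Module ℝ V]
    (P : (Fin n → ℝ) →ₗ[ℝ] V) (x : Fin n → ℝ) : P x = ∑ j, x j • P (Pi.single j 1) := by
  have hx : x = ∑ j, x j • (Pi.single j (1 : ℝ) : Fin n → ℝ) := by
    funext i
    simp only [Finset.sum_apply, Pi.smul_apply, Pi.single_apply, smul_eq_mul, mul_ite, mul_one,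
      mul_zero, Finset.sum_ite_eq, Finset.mem_univ, if_true]
  conv_lhs => rw [hx]
  rw [map_sum]
  simp only [map_smul]

/-- The coefficient matrices of the slack pencil of a linear pencil `P` in `n` variables:
`Q (castSucc j) = P(δ_j)` and `Q (last n) = 1`, so that `Σ_j x_j • Q_j = P(x ∘ castSucc) + x_n • 1`.
[folklore] -/
theorem permanentalCones_sum_smul_slackCoeff (P : (Fin n → ℝ) →ₗ[ℝ] Matrix (Fin N) (Fin N) ℝ)
    (x : Fin (n + 1) → ℝ) :
    ∑ j, x j • @Fin.snoc n (fun _ => Matrix (Fin N) (Fin N) ℝ) (fun j => P (Pi.single j 1)) 1 j =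
      P (fun j => x (Fin.castSucc j)) + x (Fin.last n) • (1 : Matrix (Fin N) (Fin N) ℝ) := by
  rw [Fin.sum_univ_castSucc]
  simp only [Fin.snoc_castSucc, Fin.snoc_last]
  rw [permanentalCones_linearMap_apply_eq_sum P]

/-- Complex version: `Σ_j w_j • Q_j = P(x ∘ castSucc) + (x_n + z) • 1` over `ℂ` at the point
`w = x + z δ_n`. [folklore] -/
theorem permanentalCones_sum_smul_slackCoeff_complex
    (P : (Fin n → ℝ) →ₗ[ℝ] Matrix (Fin N) (Fin N) ℝ) (x : Fin (n + 1) → ℝ) (z : ℂ) :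
    (∑ j, ((x j : ℂ) + z * ((Pi.single (Fin.last n) (1 : ℝ) : Fin (n + 1) → ℝ) j : ℂ)) •
        (@Fin.snoc n (fun _ => Matrix (Fin N) (Fin N) ℝ) (fun j => P (Pi.single j 1)) 1 j).map
          (algebraMap ℝ ℂ)) =
      (P (fun j => x (Fin.castSucc j))).map (algebraMap ℝ ℂ) +
        ((x (Fin.last n) : ℂ) + z) • (1 : Matrix (Fin N) (Fin N) ℂ) := by
  rw [Fin.sum_univ_castSucc]
  simp only [Fin.snoc_castSucc, Fin.snoc_last, Pi.single_apply, Fin.castSucc_ne_last, if_false,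
    if_true, Complex.ofReal_zero, Complex.ofReal_one, mul_zero, add_zero, mul_one,
    Matrix.map_one (algebraMap ℝ ℂ) (map_zero _) (map_one _)]
  congr 1
  rw [permanentalCones_linearMap_apply_eq_sum P]
  ext i l
  simp [Matrix.sum_apply]

end Slack

section Bridges

/-- **Bridge 1: crux #3 implies stub B.** `HyperbolicDetShadow` (item `stmt-ValiantsHypothesis-8653`)
implies the real-spectrum shadow statement `stub_realSpectrumShadow` of line `birth`, with the same
constant `c`: apply it to the slack pencil `Σ_{j<n} x_j P(δ_j) + x_n · 1` (a linear determinantal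
representation of a degree-`N` form hyperbolic w.r.t. `δ_n`) and take the section `x_n = 0` of the
lifted-LMI description. [folklore] -/
theorem permanentalCones_realSpectrumShadow_of_hyperbolicDetShadow :
    Summit.ValiantsHypothesis.ValiantsHypothesis.Theses.PermanentalCones.HyperbolicDetShadow →
      ∃ c : ℕ, ∀ (n N : ℕ) (P : (Fin n → ℝ) →ₗ[ℝ] Matrix (Fin N) (Fin N) ℝ),
        (∀ (x : Fin n → ℝ) (z : ℂ),
          ((P x).map (algebraMap ℝ ℂ) - z • (1 : Matrix (Fin N) (Fin N) ℂ)).det = 0 → z.im = 0) →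
        ∃ m ≤ 2 ^ ((Nat.log 2 N + c) ^ c),
          ∃ (p : ℕ) (A : (Fin n → ℝ) × (Fin p → ℝ) →ₗ[ℝ] Matrix (Fin m) (Fin m) ℝ)
            (B : Matrix (Fin m) (Fin m) ℝ), ∀ x : Fin n → ℝ,
            (∀ τ : ℝ, 0 < τ → (P x + τ • (1 : Matrix (Fin N) (Fin N) ℝ)).det ≠ 0) ↔
              ∃ y : Fin p → ℝ, (A (x, y) + B).PosSemidef := by
  intro h
  obtain ⟨c, hc⟩ := h
  refine ⟨c, fun n N P hP => ?_⟩
  -- the slack pencil `M = Σ_j X_j • Q_j`, `Q = (P(δ_0), …, P(δ_{n-1}), 1)`, direction `e = δ_n`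
  set Q : Fin (n + 1) → Matrix (Fin N) (Fin N) ℝ :=
    @Fin.snoc n (fun _ => Matrix (Fin N) (Fin N) ℝ) (fun j => P (Pi.single j 1)) 1 with hQ
  set M : Matrix (Fin N) (Fin N) (MvPolynomial (Fin (n + 1)) ℝ) :=
    Matrix.of fun i l => ∑ j, C (Q j i l) * X j with hM
  set e : Fin (n + 1) → ℝ := Pi.single (Fin.last n) 1 with he
  have hrepr : IsAffineDetRepr M.det M :=
    ⟨fun i l => permanentalCones_totalDegree_sum_C_mul_X_le _, rfl⟩
  have hhom : ∃ d : ℕ, M.det.IsHomogeneous d :=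
    ⟨N, permanentalCones_isHomogeneous_det_of_linear M fun i l =>
      permanentalCones_isHomogeneous_sum_C_mul_X _⟩
  -- real and complex evaluations of `det M` along lines
  have heval : ∀ x' : Fin (n + 1) → ℝ, eval x' M.det =
      (P (fun j => x' (Fin.castSucc j)) + x' (Fin.last n) • (1 : Matrix (Fin N) (Fin N) ℝ)).det := by
    intro x'
    rw [← permanentalCones_det_map_ringHom (eval x') M, hM, permanentalCones_linearPencil_map_eval,
      hQ, permanentalCones_sum_smul_slackCoeff]
  have hevalC : ∀ (x' : Fin (n + 1) → ℝ) (z : ℂ),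
      eval (fun j => (x' j : ℂ) + z * (e j : ℂ)) (MvPolynomial.map (algebraMap ℝ ℂ) M.det) =
        ((P (fun j => x' (Fin.castSucc j))).map (algebraMap ℝ ℂ) +
          ((x' (Fin.last n) : ℂ) + z) • (1 : Matrix (Fin N) (Fin N) ℂ)).det := by
    intro x' z
    rw [← permanentalCones_det_map_ringHom (MvPolynomial.map (algebraMap ℝ ℂ)) M,
      ← permanentalCones_det_map_ringHom (eval fun j => (x' j : ℂ) + z * (e j : ℂ)), hM,
      permanentalCones_linearPencil_map_map_eval, hQ, he, permanentalCones_sum_smul_slackCoeff_complex]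
  have hhyp : eval e M.det ≠ 0 ∧ ∀ (x' : Fin (n + 1) → ℝ) (z : ℂ),
      eval (fun j => (x' j : ℂ) + z * (e j : ℂ)) (MvPolynomial.map (algebraMap ℝ ℂ) M.det) = 0 →
        z.im = 0 := by
    refine ⟨?_, fun x' z hz => ?_⟩
    · have h0 : (fun j : Fin n => e (Fin.castSucc j)) = 0 := by
        funext j
        simp [he, Fin.castSucc_ne_last]
      rw [heval, h0, map_zero, zero_add, he]
      simp
    · rw [hevalC] at hz
      have him := hP (fun j => x' (Fin.castSucc j)) (-((x' (Fin.last n) : ℂ) + z))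
        (by rwa [neg_smul, sub_neg_eq_add])
      simpa using him
  obtain ⟨m, hm, p, A, B, hrep⟩ := hc (n + 1) N M.det M e hrepr hhom hhyp
  -- the section `x_n = 0` of the description of the cone of `det M`
  let S : (Fin n → ℝ) →ₗ[ℝ] (Fin (n + 1) → ℝ) :=
    LinearMap.pi (@Fin.snoc n (fun _ => (Fin n → ℝ) →ₗ[ℝ] ℝ) (fun j => LinearMap.proj j) 0)
  have hS1 : ∀ (x : Fin n → ℝ) (τ : ℝ) (j : Fin n), (S x + τ • e) (Fin.castSucc j) = x j := by
    intro x τ j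
    simp [S, he, LinearMap.pi_apply, Fin.snoc_castSucc, Fin.castSucc_ne_last]
  have hS2 : ∀ (x : Fin n → ℝ) (τ : ℝ), (S x + τ • e) (Fin.last n) = τ := by
    intro x τ
    simp [S, he, LinearMap.pi_apply, Fin.snoc_last]
  refine ⟨m, hm, p, A ∘ₗ (S.prodMap LinearMap.id), B, fun x => ?_⟩
  have hrepx := hrep (S x)
  simp only [LinearMap.comp_apply, LinearMap.prodMap_apply, LinearMap.id_apply]
  refine Iff.trans (forall_congr' fun τ => imp_congr_right fun _ => ?_) hrepx
  rw [heval]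
  simp only [hS1, hS2]

/-- **Bridge 2: given stub A, stub B is exactly crux #3.** Under stub A
(`stub_linearRealSpectrumNormalForm`: affine real determinantal representations of homogeneous
hyperbolic forms normalise to real-spectrum linear pencils with the same closed cone), the
real-spectrum shadow statement of stub B (`stub_realSpectrumShadow`) is equivalent to
`HyperbolicDetShadow` (item `stmt-ValiantsHypothesis-8653`), with the same constant `c` in both
directions. [folklore] -/
theorem permanentalCones_realSpectrumShadow_iff_hyperbolicDetShadow :
    (∀ (n N : ℕ) (g : MvPolynomial (Fin n) ℝ) (M : Matrix (Fin N) (Fin N) (MvPolynomial (Fin n) ℝ))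
      (e : Fin n → ℝ), Literature.Computability.AlgebraicComplexity.IsAffineDetRepr g M →
      (∃ d : ℕ, g.IsHomogeneous d) →
      (MvPolynomial.eval e g ≠ 0 ∧ ∀ (x : Fin n → ℝ) (z : ℂ),
        MvPolynomial.eval (fun j => (x j : ℂ) + z * (e j : ℂ))
          (MvPolynomial.map (algebraMap ℝ ℂ) g) = 0 → z.im = 0) →
      ∃ P : (Fin n → ℝ) →ₗ[ℝ] Matrix (Fin N) (Fin N) ℝ,
        (∀ (x : Fin n → ℝ) (z : ℂ),
          ((P x).map (algebraMap ℝ ℂ) - z • (1 : Matrix (Fin N) (Fin N) ℂ)).det = 0 → z.im = 0) ∧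
        ∀ x : Fin n → ℝ, (∀ τ : ℝ, 0 < τ → MvPolynomial.eval (x + τ • e) g ≠ 0) ↔
          ∀ τ : ℝ, 0 < τ → (P x + τ • (1 : Matrix (Fin N) (Fin N) ℝ)).det ≠ 0) →
    ((∃ c : ℕ, ∀ (n N : ℕ) (P : (Fin n → ℝ) →ₗ[ℝ] Matrix (Fin N) (Fin N) ℝ),
      (∀ (x : Fin n → ℝ) (z : ℂ),
        ((P x).map (algebraMap ℝ ℂ) - z • (1 : Matrix (Fin N) (Fin N) ℂ)).det = 0 → z.im = 0) →
      ∃ m ≤ 2 ^ ((Nat.log 2 N + c) ^ c),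
        ∃ (p : ℕ) (A : (Fin n → ℝ) × (Fin p → ℝ) →ₗ[ℝ] Matrix (Fin m) (Fin m) ℝ)
          (B : Matrix (Fin m) (Fin m) ℝ), ∀ x : Fin n → ℝ,
          (∀ τ : ℝ, 0 < τ → (P x + τ • (1 : Matrix (Fin N) (Fin N) ℝ)).det ≠ 0) ↔
            ∃ y : Fin p → ℝ, (A (x, y) + B).PosSemidef) ↔
      Summit.ValiantsHypothesis.ValiantsHypothesis.Theses.PermanentalCones.HyperbolicDetShadow) := by
  intro hA
  refine ⟨fun hB => ?_, permanentalCones_realSpectrumShadow_of_hyperbolicDetShadow⟩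
  obtain ⟨c, hc⟩ := hB
  refine ⟨c, fun n N f M e hM hhom hhyp => ?_⟩
  obtain ⟨P, hPreal, hPcone⟩ := hA n N f M e hM hhom hhyp
  obtain ⟨m, hm, p, A, B, hrep⟩ := hc n N P hPreal
  exact ⟨m, hm, p, A, B, fun x => (hPcone x).trans (hrep x)⟩

end Bridges

end Summit.ValiantsHypothesis.ValiantsHypothesis.Theorems
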